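/-
Copyright (c) 2026 the pub-hodgecm-mathlib formalisation cell (harness21).  Prover seat hodgecm-mathlib-K2E2-p12 (g6): Track B «K2-LIT», ENGINE E1,
h413 = stmt-HodgeConjecture-24833; line `K2_E1_TraceFormulaBeta`, 5Res campaign «ENDGAME BY FAMILIES», ruling (R) of K2E1-plan (g7) on `K2E1TauSphericalHeckeCommutativeU11`:
the last letter `hKconj` at `N = 2` — EVERY `g ∈ U(1,1)` IS `K_∞`-CONJUGATE TO ITS TRANSPOSE — and the letter-free arch print of Gelfand's trick for `U(J₂)(E ⊗ ℝ)`.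
-/
import Summits.HodgeConjecture.HodgeConjecture.Theorems.K2E1AntiAutHaarPreservingU   -- ★ p860556 (+ ★ p860494 transpose on `arch`, ★ p860461 Gelfand's trick, ★ `UnitaryGroupArchimedeanPlaces`: `archPiEquiv`, `archAt`, `mem_arch_iff_forall`)
import HarnessLib

/-!
# K2·E1 — `K2E1ArchTransposeKConjugateU2`: IN `U(1,1)` (antidiagonal frame `J₂ = [[0,1],[1,0]]`) EVERY `g` IS CONJUGATE TO `gᵀ` BY A UNITARY `k ∈ U(J₂) ∩ U(2)`; HENCE `hKconj` FOR
# `arch F E c 2 J` PLACE BY PLACE, AND THE LETTER-FREE PRINT «THE `χ`-SPHERICAL HECKE ALGEBRA OF `U(J₂)(E ⊗ ℝ)` IS COMMUTATIVE» (`R_∞(f₁)R_∞(f₂) = R_∞(f₂)R_∞(f₁)`)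
# [Lang SL₂(ℝ) IV §1; Helgason GGA IV §3 Thm 3.1; Knapp 1986 VIII §3]

Track B ∕ K2-LIT, crux h413 = `stmt-HodgeConjecture-24833`, route of record `HCCMUnconditional`; cell `hodgecm-mathlib`, squad K2, ENGINE E1 (5Res campaign, M2 v2 §3′.1, the `hcommTau` road:
★ p860461 Gelfand ⟶ ★ p860494 transpose ⟶ ★ p860556 Haar ⟶ THIS FILE: the structural letter `hKconj`).  THEOREMS ONLY (no `def`, no `instance`, no notation, no named-fact hypothesis,
no `sorry`; default heartbeats); lane `--supports stmt-HodgeConjecture-24833 --as helper` (count-neutral).  CLOSES NO SOCKET.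
* §1 LOCAL, `U(1,1) = {g ∈ GL₂(ℂ) | ḡᵀ J₂ g = J₂}`, `J₂ = !![0,1;1,0]`: **`exists_unitary_mul_eq_transpose_mul`** — for `g = [[a,b],[c,d]] ∈ U(J₂)` there is `k ∈ U(J₂) ∩ U(2)` with `k g = gᵀ k`:
  `k = 1` if `a = d ∧ b = c` (then `g = gᵀ`), else `k = (|a−d|² + |b−c|²)^{-1/2} · [[a−d, b−c],[b−c, a−d]]` — unitary because the four relations `Re(āc) = Re(b̄d) = 0` (from `ḡᵀJ₂g = J₂`) and
  `Re(āb) = Re(c̄d) = 0` (from `ḡJ₂gᵀ = J₂`, ★ p860494 `map_mul_form_mul_transpose_eq`) kill the cross term, and `k g = gᵀ k` reduces to `(a−d)(b−c) = (b−c)(a−d)` (★ p859876's `|b| = |c|`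
  computation transported to the antidiagonal frame).
* §2 **`hKconj_arch_two`** — for `c ≠ 1` fixing every infinite place (CM situation), `J` with `σ_w(J) = J₂` at every complex place, and ANY `θ` on `arch F E c 2 J` with `(θ g : Matrix) = (g : Matrix)ᵀ`:
  `∀ g, ∃ k ∈ arch ⊓ U(1 ⊗ 1), θ g = k g k⁻¹` (assembled from §1 through ★ `archPiEquiv : U(J)(E⊗ℝ) ≃ₜ* Π_w U(σ_w J)(ℂ)` and ★ `mem_arch_iff_forall`) — the letter `hKconj` of ★ p860494 ∕ p860556
  DISCHARGED for `N = 2`.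
* §3 **`integratedOperator_arch_comm_of_spherical_two`** — THE LETTER-FREE PRINT: for `c` an involution `≠ 1` fixing all infinite places, `J` with `J.map c = J`, `J² = 1`, `σ_w(J) = J₂`, an
  inversion-invariant Haar measure `η` on `arch F E c 2 J`, `K_∞ := arch ⊓ U(1 ⊗ 1)` (`κ = Subgroup.inclusion inf_le_left`) and a multiplicative `χ : K_∞ → ℂ` with `χ 1 = 1`: for every unitary
  strongly continuous `ρ` of `arch` and `χ`-spherical `f₁, f₂ ∈ C_c(arch)`, `ρ(f₁) ∘ ρ(f₂) = ρ(f₂) ∘ ρ(f₁)` (E1: `ρ = π.restrict archToAdelic` ⇒ `hcommTau`); `θ` is eliminated inside the proof by ★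
  `exists_transposeHomeomorph_arch`.  §3 also records `antidiagonal_two_over_map_embedding ∕ _map ∕ _mul_self`: Mok's `(StdForm.antidiagonal 2).over E` satisfies the three `J`-hypotheses.
HONEST LABEL: HC_CM is proved only modulo the 7 printed citations (2 remaining named inputs: hLiu418 = `stmt-HodgeConjecture-24832`, h413 = `stmt-HodgeConjecture-24833`) until rung 0
closes; this file asserts no named fact and closes no socket; count-neutral; unconditional.

## References
* [Helgason2000] S. Helgason, *Groups and Geometric Analysis* (AMS 2000): Ch. IV §3, Thm. 3.1; cf. S. Lang, *SL₂(ℝ)*, Ch. IV §1 (`g ↦ ᵗg`, `K`-conjugacy of `g` and `ᵗg`).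
* [Knapp1986] A. W. Knapp, *Representation Theory of Semisimple Groups* (1986): VIII §3.
* [BorelJacquet1979] A. Borel, H. Jacquet, PSPM 33.1 (1979): §4.1.
* [Mok2014] C. P. Mok, *Endoscopic classification of representations of quasi-split unitary groups*, Mem. AMS 235 (2015): §1 Notation p. 5 (`J_N`).
-/

set_option autoImplicit false
set_option linter.dupNamespace false -- the mandated namespace repeats `HodgeConjecture.HodgeConjecture`

noncomputable section

open MeasureTheory MeasureTheory.Measure Filter Topology CompactlySupported NumberField NumberField.mixedEmbedding NumberField.InfinitePlace
open Literature.NumberTheory.Automorphic Literature.NumberTheory.Automorphic.UnitaryGroup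
open Summit.HodgeConjecture.HodgeConjecture.Cruxes.H413.K2E1ArchTransposeAntiAutU (exists_transposeHomeomorph_arch)
open Summit.HodgeConjecture.HodgeConjecture.Cruxes.H413.K2E1AntiAutHaarPreservingU (integratedOperator_arch_comm_of_spherical')
open scoped Matrix ComplexConjugate

namespace Summit.HodgeConjecture.HodgeConjecture.Cruxes.H413.K2E1ArchTransposeKConjugateU2

/-! ## §1 Local: in `U(1,1)` every `g` is conjugate to `gᵀ` by an element of `U(J₂) ∩ U(2)` -/

/-- `J₂ = [[0,1],[1,0]]` has real (conjugation-fixed) entries. [folklore] -/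
theorem antidiag_two_map_star : (!![(0 : ℂ), 1; 1, 0]).map (starRingEnd ℂ) = !![(0 : ℂ), 1; 1, 0] := by
  ext i j; fin_cases i <;> fin_cases j <;> simp

/-- `J₂² = 1`. [folklore] -/
theorem antidiag_two_mul_self : !![(0 : ℂ), 1; 1, 0] * !![(0 : ℂ), 1; 1, 0] = 1 := by
  ext i j; fin_cases i <;> fin_cases j <;> simp [Matrix.mul_apply, Fin.sum_univ_two]

/-- **IN `U(1,1)` EVERY `g` IS `K`-CONJUGATE TO ITS TRANSPOSE** (antidiagonal frame): for `g ∈ U(J₂) = {ḡᵀ J₂ g = J₂} ≤ GL₂(ℂ)` there is `k ∈ U(J₂) ∩ U(2)` with `k · g = gᵀ · k`.  With `g = [[a,b],[c,d]]`: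
`k = 1` when `a = d`, `b = c`; otherwise `k ∝ [[a−d, b−c],[b−c, a−d]]`, unitary since `Re(āb) = Re(āc) = Re(b̄d) = Re(c̄d) = 0`.  (★ p859876 `exists_kV_conj_eq_transpose_one_one` in the diagonal frame.)
[cite: Helgason2000, Ch. IV §3 Thm. 3.1] [cite: Knapp1986, VIII §3] -/
theorem exists_unitary_mul_eq_transpose_mul (g : GL (Fin 2) ℂ) (hg : g ∈ unitaryGroupOfForm (starRingEnd ℂ) !![(0 : ℂ), 1; 1, 0]) :
    ∃ k : GL (Fin 2) ℂ, k ∈ unitaryGroupOfForm (starRingEnd ℂ) !![(0 : ℂ), 1; 1, 0] ∧ k ∈ unitaryGroupOfForm (starRingEnd ℂ) 1 ∧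
      (k : Matrix (Fin 2) (Fin 2) ℂ) * g = ((g : Matrix (Fin 2) (Fin 2) ℂ))ᵀ * k := by
  set a : ℂ := (g : Matrix (Fin 2) (Fin 2) ℂ) 0 0 with ha
  set b : ℂ := (g : Matrix (Fin 2) (Fin 2) ℂ) 0 1 with hb
  set e : ℂ := (g : Matrix (Fin 2) (Fin 2) ℂ) 1 0 with he
  set d : ℂ := (g : Matrix (Fin 2) (Fin 2) ℂ) 1 1 with hd
  have hgM : (g : Matrix (Fin 2) (Fin 2) ℂ) = !![a, b; e, d] := by
    ext i j; fin_cases i <;> fin_cases j <;> rfl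
  -- the relations `ḡᵀ J g = J` and `ḡ J gᵀ = J`
  have h1 : (((g : Matrix (Fin 2) (Fin 2) ℂ)).map (starRingEnd ℂ))ᵀ * !![(0 : ℂ), 1; 1, 0] * (g : Matrix (Fin 2) (Fin 2) ℂ) = !![(0 : ℂ), 1; 1, 0] := hg
  have h2 := Summit.HodgeConjecture.HodgeConjecture.Cruxes.H413.K2E1ArchTransposeAntiAutU.map_mul_form_mul_transpose_eq (starRingEnd ℂ) (!![(0 : ℂ), 1; 1, 0]) (fun x => star_star x)
    antidiag_two_map_star antidiag_two_mul_self hg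
  rw [Matrix.transpose_map, Matrix.transpose_transpose] at h2
  rw [hgM] at h1 h2
  have E00 := congrFun (congrFun h1 0) 0
  have E11 := congrFun (congrFun h1 1) 1
  have F00 := congrFun (congrFun h2 0) 0
  have F11 := congrFun (congrFun h2 1) 1
  simp [Matrix.mul_apply, Fin.sum_univ_two] at E00 E11 F00 F11
  -- E00 : conj e * a + conj a * e = 0 ; E11 : conj d * b + conj b * d = 0 ; F00 : conj b * a + conj a * b = 0 ; F11 : conj d * e + conj e * d = 0 (up to order)
  by_cases h0 : a - d = 0 ∧ b - e = 0
  · refine ⟨1, one_mem _, one_mem _, ?_⟩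
    have hbe : b = e := sub_eq_zero.mp h0.2
    rw [Units.val_one, Matrix.one_mul, Matrix.mul_one, hgM]
    ext i j; fin_cases i <;> fin_cases j <;> simp [hbe]
  · -- the normalising factor
    set p : ℂ := a - d with hp
    set q : ℂ := b - e with hq
    have hr : 0 < Complex.normSq p + Complex.normSq q := by
      rcases not_and_or.mp h0 with hp0 | hq0
      · exact add_pos_of_pos_of_nonneg (Complex.normSq_pos.mpr hp0) (Complex.normSq_nonneg _)
      · exact add_pos_of_nonneg_of_pos (Complex.normSq_nonneg _) (Complex.normSq_pos.mpr hq0)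
    set r : ℝ := Complex.normSq p + Complex.normSq q with hrdef
    set s : ℝ := (Real.sqrt r)⁻¹ with hs
    have hs2 : (s : ℂ) * s * r = 1 := by
      have hsr : s * s * r = 1 := by
        rw [hs, ← mul_inv, Real.mul_self_sqrt hr.le, inv_mul_cancel₀ hr.ne']
      exact_mod_cast hsr
    -- the cross term vanishes
    have hX : conj p * q + conj q * p = 0 := by
      rw [hp, hq, map_sub, map_sub]
      linear_combination F00 - E00 - E11 + F11
    set kM : Matrix (Fin 2) (Fin 2) ℂ := (s : ℂ) • !![p, q; q, p] with hkM
    have hkk : kMᴴ * kM = 1 := by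
      rw [hkM, Matrix.conjTranspose_smul, Matrix.smul_mul, Matrix.mul_smul, smul_smul, Complex.star_def, Complex.conj_ofReal]
      have hpq : conj p * p + conj q * q = r := by
        rw [hrdef, Complex.ofReal_add, Complex.normSq_eq_conj_mul_self, Complex.normSq_eq_conj_mul_self]
      ext i j; fin_cases i <;> fin_cases j <;>
        simp [Matrix.mul_apply, Fin.sum_univ_two, Matrix.conjTranspose_apply]
      · linear_combination (s : ℂ) * s * hpq + hs2
      · right; linear_combination hX
      · right; linear_combination hX
      · rw [show (starRingEnd ℂ) q * q + (starRingEnd ℂ) p * p = conj p * p + conj q * q by ring]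
        linear_combination (s : ℂ) * s * hpq + hs2
    have hkk' : kM * kMᴴ = 1 := mul_eq_one_comm.mp hkk
    let k : GL (Fin 2) ℂ := ⟨kM, kMᴴ, hkk', hkk⟩
    have hkJ : !![(0 : ℂ), 1; 1, 0] * kM = kM * !![(0 : ℂ), 1; 1, 0] := by
      rw [hkM, Matrix.mul_smul, Matrix.smul_mul]
      congr 1
      ext i j; fin_cases i <;> fin_cases j <;> simp [Matrix.mul_apply, Fin.sum_univ_two]
    have hconj : (kM.map (starRingEnd ℂ))ᵀ = kMᴴ := by
      rw [Matrix.conjTranspose, Matrix.transpose_map]; rfl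
    refine ⟨k, ?_, ?_, ?_⟩
    · show (kM.map (starRingEnd ℂ))ᵀ * !![(0 : ℂ), 1; 1, 0] * kM = !![(0 : ℂ), 1; 1, 0]
      rw [hconj, Matrix.mul_assoc, hkJ, ← Matrix.mul_assoc, hkk, Matrix.one_mul]
    · show (kM.map (starRingEnd ℂ))ᵀ * 1 * kM = 1
      rw [hconj, Matrix.mul_one, hkk]
    · show kM * (g : Matrix (Fin 2) (Fin 2) ℂ) = ((g : Matrix (Fin 2) (Fin 2) ℂ))ᵀ * kM
      rw [hkM, Matrix.smul_mul, Matrix.mul_smul, hgM]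
      congr 1
      ext i j; fin_cases i <;> fin_cases j <;> simp [Matrix.mul_apply, Fin.sum_univ_two, hp, hq] <;> ring


/-! ## §2 `hKconj` for `arch F E c 2 J`, place by place -/

section Arch

variable (F E : Type) [Field F] [Field E] [Algebra F E] (c : E ≃ₐ[F] E) (J : Matrix (Fin 2) (Fin 2) E)

/-- **`hKconj` AT `N = 2` DISCHARGED**: for `c ≠ 1` fixing every infinite place of `E`, `J` with `σ_w(J) = J₂` at every complex place `w`, and any `θ : arch → arch` with `(θ g : Matrix) = (g : Matrix)ᵀ`,
every `g ∈ U(J)(E ⊗ ℝ)` satisfies `θ g = k g k⁻¹` for some `k ∈ U(J)(E⊗ℝ) ∩ U(1 ⊗ 1)` (★ `archPiEquiv`: choose the §1 conjugator at each place; unitarity and the identity are checked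
place by place, ★ `mem_arch_iff_forall`, ★ `coe_archAt_apply`). [cite: Helgason2000, Ch. IV §3 Thm. 3.1] [cite: BorelJacquet1979, §4.1] -/
theorem hKconj_arch_two (hc : c ≠ 1) (hfix : ∀ w : InfinitePlace E, c • w = w)
    (hJw : ∀ w : {w : InfinitePlace E // IsComplex w}, J.map w.1.embedding = !![(0 : ℂ), 1; 1, 0])
    (θ : ↥(arch F E c 2 J) → ↥(arch F E c 2 J))
    (hθT : ∀ g : ↥(arch F E c 2 J), (((θ g : ↥(arch F E c 2 J)) : GL (Fin 2) (mixedSpace E)) : Matrix (Fin 2) (Fin 2) (mixedSpace E)) =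
      (((g : GL (Fin 2) (mixedSpace E)) : Matrix (Fin 2) (Fin 2) (mixedSpace E)))ᵀ)
    (g : ↥(arch F E c 2 J)) :
    ∃ k : ↥(arch F E c 2 J ⊓ unitaryGroupOfForm (conjMixed F E c) 1),
      θ g = Subgroup.inclusion inf_le_left k * g * (Subgroup.inclusion inf_le_left k)⁻¹ := by
  -- local components and local conjugators
  have hgw : ∀ w : {w : InfinitePlace E // IsComplex w}, ((archAt F E c 2 J w (hfix w.1) hc g : archLocal E 2 J w) : GL (Fin 2) ℂ) ∈
      unitaryGroupOfForm (starRingEnd ℂ) !![(0 : ℂ), 1; 1, 0] := by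
    intro w
    have h := (archAt F E c 2 J w (hfix w.1) hc g).2
    change ((archAt F E c 2 J w (hfix w.1) hc g : archLocal E 2 J w) : GL (Fin 2) ℂ) ∈ unitaryGroupOfForm (starRingEnd ℂ) (J.map w.1.embedding) at h
    rwa [hJw w] at h
  choose kw hkwJ hkw1 hkwT using fun w => exists_unitary_mul_eq_transpose_mul _ (hgw w)
  have hkwmem : ∀ w : {w : InfinitePlace E // IsComplex w}, kw w ∈ archLocal E 2 J w := fun w => by
    change kw w ∈ unitaryGroupOfForm (starRingEnd ℂ) (J.map w.1.embedding)
    rw [hJw w]; exact hkwJ w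
  set kfam : ∀ w : {w : InfinitePlace E // IsComplex w}, archLocal E 2 J w := fun w => ⟨kw w, hkwmem w⟩ with hkfam
  set k : ↥(arch F E c 2 J) := (archPiEquiv F E c 2 J hc hfix).symm kfam with hk
  -- `k` is unitary (`k ∈ U(1 ⊗ 1)`), checked place by place
  have h1form : archFormOf E 2 (1 : Matrix (Fin 2) (Fin 2) E) = 1 := Matrix.map_one _ (map_zero _) (map_one _)
  have hkU : (k : GL (Fin 2) (mixedSpace E)) ∈ unitaryGroupOfForm (conjMixed F E c) 1 := by
    have hk1 : (k : GL (Fin 2) (mixedSpace E)) ∈ arch F E c 2 (1 : Matrix (Fin 2) (Fin 2) E) := by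
      refine (mem_arch_iff_forall F E c 2 (1 : Matrix (Fin 2) (Fin 2) E) hc hfix _).2 fun w => ?_
      have hmap : Matrix.GeneralLinearGroup.map (evalC E w) (k : GL (Fin 2) (mixedSpace E)) = kw w := by
        have h := congrArg (fun x : archLocal E 2 J w => (x : GL (Fin 2) ℂ)) (archAt_archPiEquiv_symm F E c 2 J hc hfix kfam w)
        exact h
      change Matrix.GeneralLinearGroup.map (evalC E w) (k : GL (Fin 2) (mixedSpace E)) ∈ unitaryGroupOfForm (starRingEnd ℂ) ((1 : Matrix (Fin 2) (Fin 2) E).map w.1.embedding)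
      rw [hmap, Matrix.map_one _ (map_zero _) (map_one _)]
      exact hkw1 w
    change (k : GL (Fin 2) (mixedSpace E)) ∈ unitaryGroupOfForm (conjMixed F E c) (archFormOf E 2 (1 : Matrix (Fin 2) (Fin 2) E)) at hk1
    rwa [h1form] at hk1
  refine ⟨⟨(k : GL (Fin 2) (mixedSpace E)), k.2, hkU⟩, ?_⟩
  have hincl : (Subgroup.inclusion (inf_le_left : arch F E c 2 J ⊓ unitaryGroupOfForm (conjMixed F E c) 1 ≤ arch F E c 2 J)
      ⟨(k : GL (Fin 2) (mixedSpace E)), k.2, hkU⟩) = k := Subtype.ext rfl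
  rw [hincl]
  -- compare place by place
  apply (archPiEquiv F E c 2 J hc hfix).injective
  rw [map_mul, map_mul, map_inv, hk, ContinuousMulEquiv.apply_symm_apply]
  funext w
  rw [Pi.mul_apply, Pi.mul_apply, Pi.inv_apply, archPiEquiv_apply, archPiEquiv_apply]
  apply Subtype.ext
  apply Units.ext
  have hL : (((archAt F E c 2 J w (hfix w.1) hc (θ g) : archLocal E 2 J w) : GL (Fin 2) ℂ) : Matrix (Fin 2) (Fin 2) ℂ) =
      ((((archAt F E c 2 J w (hfix w.1) hc g : archLocal E 2 J w) : GL (Fin 2) ℂ) : Matrix (Fin 2) (Fin 2) ℂ))ᵀ :=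
    Matrix.ext fun i j => by rw [coe_archAt_apply, Matrix.transpose_apply, coe_archAt_apply, hθT, Matrix.transpose_apply]
  rw [hL, Subgroup.coe_mul, Subgroup.coe_mul, Subgroup.coe_inv, Units.val_mul, Units.val_mul]
  change _ = ((kw w : GL (Fin 2) ℂ) : Matrix (Fin 2) (Fin 2) ℂ) * _ * (((kw w)⁻¹ : GL (Fin 2) ℂ) : Matrix (Fin 2) (Fin 2) ℂ)
  symm
  rw [hkwT w, Matrix.mul_assoc, ← Units.val_mul, mul_inv_cancel, Units.val_one, Matrix.mul_one]


/-! ## §3 The letter-free print for `U(J₂)(E ⊗ ℝ)` and Mok's `J₂` -/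

/-- **THE `χ`-SPHERICAL HECKE ALGEBRA OF `U(J₂)(E ⊗ ℝ)` IS COMMUTATIVE — LETTER-FREE** (`c` an involution `≠ 1` fixing all infinite places; `J.map c = J`, `J² = 1`, `σ_w(J) = J₂`; `η` an
inversion-invariant Haar measure on `arch F E c 2 J`; `K_∞ = arch ⊓ U(1 ⊗ 1)`, `χ : K_∞ → ℂ` multiplicative with `χ 1 = 1`): for every unitary strongly continuous `ρ` of `arch F E c 2 J` and
`χ`-spherical `f₁, f₂ ∈ C_c`, `ρ(f₁) ∘ ρ(f₂) = ρ(f₂) ∘ ρ(f₁)`.  PROOF: `θ = ᵀ` exists (★ `exists_transposeHomeomorph_arch`), preserves `η` (★ p860556), and §2 gives `hKconj`; ★ p860461 Gelfand.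
E1 (`ρ = π.restrict archToAdelic`): the letter `hcommTau` of the D-road, now a theorem for `N = 2`. [cite: Helgason2000, Ch. IV §3 Thm. 3.1] [cite: Knapp1986, VIII §3] -/
theorem integratedOperator_arch_comm_of_spherical_two [NumberField E] (hc : c ≠ 1) (hfix : ∀ w : InfinitePlace E, c • w = w) (hcc : ∀ x, c (c x) = x)
    (hJc : J.map (c : E → E) = J) (hJ2 : J * J = 1) (hJw : ∀ w : {w : InfinitePlace E // IsComplex w}, J.map w.1.embedding = !![(0 : ℂ), 1; 1, 0])
    [MeasurableSpace ↥(arch F E c 2 J)] [BorelSpace ↥(arch F E c 2 J)]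
    (η : Measure ↥(arch F E c 2 J)) [IsHaarMeasure η] [η.IsInvInvariant] [SFinite η]
    (χ : ↥(arch F E c 2 J ⊓ unitaryGroupOfForm (conjMixed F E c) 1) → ℂ) (hχmul : ∀ k l, χ (k * l) = χ k * χ l) (hχone : χ 1 = 1)
    {V : Type*} [NormedAddCommGroup V] [InnerProductSpace ℂ V] [CompleteSpace V] (ρ : ContRepresentation ℂ ↥(arch F E c 2 J) V) (hu : ρ.IsUnitary) (hc' : ρ.IsStronglyContinuous)
    (f₁ f₂ : C_c(↥(arch F E c 2 J), ℂ))
    (h₁l : ∀ (k : ↥(arch F E c 2 J ⊓ unitaryGroupOfForm (conjMixed F E c) 1)) (x : ↥(arch F E c 2 J)), f₁ (Subgroup.inclusion inf_le_left k * x) = χ k * f₁ x)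
    (h₁r : ∀ (k : ↥(arch F E c 2 J ⊓ unitaryGroupOfForm (conjMixed F E c) 1)) (x : ↥(arch F E c 2 J)), f₁ (x * Subgroup.inclusion inf_le_left k) = χ k * f₁ x)
    (h₂l : ∀ (k : ↥(arch F E c 2 J ⊓ unitaryGroupOfForm (conjMixed F E c) 1)) (x : ↥(arch F E c 2 J)), f₂ (Subgroup.inclusion inf_le_left k * x) = χ k * f₂ x)
    (h₂r : ∀ (k : ↥(arch F E c 2 J ⊓ unitaryGroupOfForm (conjMixed F E c) 1)) (x : ↥(arch F E c 2 J)), f₂ (x * Subgroup.inclusion inf_le_left k) = χ k * f₂ x) :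
    ρ.integratedOperator hu hc' η f₁ ∘L ρ.integratedOperator hu hc' η f₂ = ρ.integratedOperator hu hc' η f₂ ∘L ρ.integratedOperator hu hc' η f₁ := by
  obtain ⟨θ, hθT⟩ := exists_transposeHomeomorph_arch F E c 2 J hcc hJc hJ2
  exact integratedOperator_arch_comm_of_spherical' F E c 2 J θ hθT η (Subgroup.inclusion inf_le_left) χ hχmul hχone
    (hKconj_arch_two F E c J hc hfix hJw θ hθT) ρ hu hc' f₁ f₂ h₁l h₁r h₂l h₂r

/-- Mok's `J₂ = (StdForm.antidiagonal 2).over E` is `[[0,1],[1,0]]` at every complex place. [cite: Mok2014, §1 Notation p. 5] -/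
theorem antidiagonal_two_over_map_embedding (w : {w : InfinitePlace E // IsComplex w}) :
    ((StdForm.antidiagonal 2).over E).map w.1.embedding = !![(0 : ℂ), 1; 1, 0] := by
  ext i j; fin_cases i <;> fin_cases j <;> simp [StdForm.over, StdForm.antidiagonal, Fin.rev]

/-- Mok's `J₂` has `c`-fixed entries. [cite: Mok2014, §1 Notation p. 5] -/
theorem antidiagonal_two_over_map : ((StdForm.antidiagonal 2).over E).map (c : E → E) = (StdForm.antidiagonal 2).over E := by
  ext i j; fin_cases i <;> fin_cases j <;> simp [StdForm.over, StdForm.antidiagonal, Fin.rev]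

/-- `J₂² = 1` for Mok's `J₂`. [cite: Mok2014, §1 Notation p. 5] -/
theorem antidiagonal_two_over_mul_self : (StdForm.antidiagonal 2).over E * (StdForm.antidiagonal 2).over E = 1 := by
  ext i j; fin_cases i <;> fin_cases j <;> simp [StdForm.over, StdForm.antidiagonal, Fin.rev, Matrix.mul_apply, Fin.sum_univ_two]

end Arch

end Summit.HodgeConjecture.HodgeConjecture.Cruxes.H413.K2E1ArchTransposeKConjugateU2

end
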